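import Mathlib
import Summits.ResolutionOfSingularities.ResolutionOfSingularities.Theorems.RadicialJungCleanModelsValuationRefinement
import Summits.ResolutionOfSingularities.ResolutionOfSingularities.Theorems.RadicialJungCleanModelsCleanLUGenerises
import Summits.ResolutionOfSingularities.ResolutionOfSingularities.Theorems.RadicialJungCleanModelsLineRepresentativeTwist
import HarnessLib

/-!
# Crux stmt-ResolutionOfSingularities-15917 (`RadicialJung.CleanModels`), skeleton `Sketch` rev 13, stub `stub_cleanPatching3`:
# clean local uniformization at 3-dimensional centres gives clean-regular models at EVERY centre of a regular threefold model

Plan card `Cruxes/CleanModels/Lines/Sketch-P2-plan.md` (lead `res-B-lead-1` g0, 2026-08-28).  Rev 13 of the skeleton asks clean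
local uniformization (`CleanLU3`, proved from the frame as `stub_cleanLU3_of_frame`, p659322) only at valuations whose centre on
the regular affine model `A` has a 3-dimensional local ring (Cossart–Piltant's own (LU) hypothesis, Prop 4.6).  This file shows
that this suffices for EVERY valuation centred on `A`, as long as `A` is a regular model all of whose maximal ideals have
height 3 (an affine open of a regular integral threefold of finite type over a field): refine the valuation ring `O` to
`O' ≤ O` with centre a maximal ideal above the centre of `O` (`exists_valuationSubring_le_centre_eq`, p659805), apply `CleanLU3`
at `O'`, generise regularity and loose cleanness back to the centre of `O` (`looseClean_generises_of_le`, up to a twist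
`e^p x^α - d^p`) and re-normalise the representative of the `K^p`-line (`nonTrivRep_twist`, p660208).

* `cleanLU_of_cleanLU3_dimThreeCentres` — the assembled step (input shape = `CleanLU3` at the prime `p`; output shape =
  its conclusion at an arbitrary valuation ring `O` centred on `A`).

This is the «Step 1 for all valuations» input of Zariski-style patching for clean pairs; the compactness / domination steps of
`stub_cleanPatching3` remain.  Nothing here proves resolution in characteristic `p`.
-/

noncomputable section

set_option linter.dupNamespace false

open IsLocalRing
open Literature.AlgebraicGeometry.Resolution

namespace Summit.ResolutionOfSingularities.ResolutionOfSingularities.Theorems.RadicialJung.CleanModels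

/-- **Clean LU at 3-dimensional centres ⟹ clean-regular models at every centre of a regular threefold model.**  Let `k` be a
field of characteristic `p` and suppose clean local uniformization holds at `p` for valuations with 3-dimensional centre
(the hypothesis `hLU`, = `CleanLU3` at `p`).  Let `K ⊇ k` be a field, `O` a valuation subring of `K`, `A ⊆ O` a finitely
generated `k`-subalgebra with `Frac A = K`, `dim A ≤ 3`, all of whose localisations at maximal ideals are regular of dimension
`3`, and `g₀ ∈ K ∖ K^p`.  Then some finitely generated `A ⊆ A' ⊆ O` is regular at the centre of `O` and carries there a loosely
clean non-trivial representative of the `K^p`-line of `g₀`. [folklore] -/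
theorem cleanLU_of_cleanLU3_dimThreeCentres (p : ℕ) (hp : p.Prime)
    (hLU : ∀ (k : Type) [Field k] [CharP k p] (K : Type) [Field K] [Algebra k K]
      (O : ValuationSubring K) (A : Subalgebra k K), A.toSubring ≤ O.toSubring → A.FG → IsFractionRing A K →
      ringKrullDim A ≤ 3 → IsRegularLocalRing (locAtCentre A.toSubring O) →
      ringKrullDim (locAtCentre A.toSubring O) = 3 →
      ∀ g₀ : K, (∀ c : K, c ^ p ≠ g₀) →
      ∃ (A' : Subalgebra k K), A'.toSubring ≤ O.toSubring ∧ A ≤ A' ∧ A'.FG ∧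
        ∃ (_ : IsRegularLocalRing (locAtCentre A'.toSubring O)) (c : Fin p → K), (∃ j : Fin p, (j : ℕ) ≠ 0 ∧ c j ≠ 0) ∧
          ((∃ (d m : ℕ) (hmd : m ≤ d) (t : Fin d → ↥(locAtCentre A'.toSubring O)) (a : Fin m → ℕ) (u : ↥(locAtCentre A'.toSubring O)), IsUnit u ∧
              Ideal.span (Set.range t) = IsLocalRing.maximalIdeal ↥(locAtCentre A'.toSubring O) ∧
              ringKrullDim ↥(locAtCentre A'.toSubring O) = (d : WithBot ℕ∞) ∧ 0 < m ∧ (∀ i, ¬ p ∣ a i) ∧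
              (∑ j : Fin p, c j ^ p * g₀ ^ (j : ℕ)) = (u : K) * ∏ i : Fin m, ((t (Fin.castLE hmd i) : ↥(locAtCentre A'.toSubring O)) : K) ^ (a i)) ∨
            (∃ u : ↥(locAtCentre A'.toSubring O), IsUnit u ∧ (∑ j : Fin p, c j ^ p * g₀ ^ (j : ℕ)) = (u : K) ∧
              ∀ c' : ↥(locAtCentre A'.toSubring O), u - c' ^ p ∉ IsLocalRing.maximalIdeal ↥(locAtCentre A'.toSubring O)) ∨
            (∃ s c' : ↥(locAtCentre A'.toSubring O), (∑ j : Fin p, c j ^ p * g₀ ^ (j : ℕ)) = (s : K) ∧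
              s - c' ^ p ∈ IsLocalRing.maximalIdeal ↥(locAtCentre A'.toSubring O) ∧
              s - c' ^ p ∉ IsLocalRing.maximalIdeal ↥(locAtCentre A'.toSubring O) ^ 2)))
    (k : Type) [Field k] [CharP k p] (K : Type) [Field K] [Algebra k K]
    (O : ValuationSubring K) (A : Subalgebra k K) (hAO : A.toSubring ≤ O.toSubring) (hAfg : A.FG)
    (hfrac : IsFractionRing A K) (hdimA : ringKrullDim A ≤ 3)
    (hmax : ∀ (𝔪 : Ideal A.toSubring) [𝔪.IsMaximal],
      IsRegularLocalRing (Localization.AtPrime 𝔪) ∧ ringKrullDim (Localization.AtPrime 𝔪) = 3)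
    (g₀ : K) (hg₀ : ∀ c : K, c ^ p ≠ g₀) :
    ∃ (A' : Subalgebra k K), A'.toSubring ≤ O.toSubring ∧ A ≤ A' ∧ A'.FG ∧
      ∃ (_ : IsRegularLocalRing (locAtCentre A'.toSubring O)) (c : Fin p → K), (∃ j : Fin p, (j : ℕ) ≠ 0 ∧ c j ≠ 0) ∧
        ((∃ (d m : ℕ) (hmd : m ≤ d) (t : Fin d → ↥(locAtCentre A'.toSubring O)) (a : Fin m → ℕ) (u : ↥(locAtCentre A'.toSubring O)), IsUnit u ∧
              Ideal.span (Set.range t) = IsLocalRing.maximalIdeal ↥(locAtCentre A'.toSubring O) ∧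
              ringKrullDim ↥(locAtCentre A'.toSubring O) = (d : WithBot ℕ∞) ∧ 0 < m ∧ (∀ i, ¬ p ∣ a i) ∧
              (∑ j : Fin p, c j ^ p * g₀ ^ (j : ℕ)) = (u : K) * ∏ i : Fin m, ((t (Fin.castLE hmd i) : ↥(locAtCentre A'.toSubring O)) : K) ^ (a i)) ∨
            (∃ u : ↥(locAtCentre A'.toSubring O), IsUnit u ∧ (∑ j : Fin p, c j ^ p * g₀ ^ (j : ℕ)) = (u : K) ∧
              ∀ c' : ↥(locAtCentre A'.toSubring O), u - c' ^ p ∉ IsLocalRing.maximalIdeal ↥(locAtCentre A'.toSubring O)) ∨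
            (∃ s c' : ↥(locAtCentre A'.toSubring O), (∑ j : Fin p, c j ^ p * g₀ ^ (j : ℕ)) = (s : K) ∧
              s - c' ^ p ∈ IsLocalRing.maximalIdeal ↥(locAtCentre A'.toSubring O) ∧
              s - c' ^ p ∉ IsLocalRing.maximalIdeal ↥(locAtCentre A'.toSubring O) ^ 2)) := by
  classical
  haveI : Fact p.Prime := ⟨hp⟩
  haveI : CharP K p := charP_of_injective_algebraMap (algebraMap k K).injective p
  -- a maximal ideal above the centre of `O` on `A`
  obtain ⟨𝔪, h𝔪, h𝔭𝔪⟩ := Ideal.exists_le_maximal (subringCentre A.toSubring O hAO) Ideal.IsPrime.ne_top'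
  have hcentre : ∀ a : A.toSubring, O.valuation (a : K) < 1 → a ∈ 𝔪 :=
    fun a ha => h𝔭𝔪 ((mem_subringCentre_iff hAO a).mpr ha)
  -- refine the valuation ring
  obtain ⟨O', hO'O, hAO', hc𝔪⟩ := exists_valuationSubring_le_centre_eq O A.toSubring hAO 𝔪 hcentre
  have hcen : subringCentre A.toSubring O' hAO' = 𝔪 := by
    ext a
    rw [mem_subringCentre_iff, hc𝔪]
  -- the local ring of `A` at the centre of `O'` is `A_𝔪`: regular of dimension `3`
  subst hcen
  haveI := h𝔪
  obtain ⟨hreg𝔪, hdim𝔪⟩ := hmax (subringCentre A.toSubring O' hAO')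
  have hregO' : IsRegularLocalRing (locAtCentre A.toSubring O') :=
    (isRegularLocalRing_locAtCentre_iff hAO').mpr hreg𝔪
  have hdimO' : ringKrullDim (locAtCentre A.toSubring O') = 3 := by
    rw [← ringKrullDim_eq_of_ringEquiv (locAtCentreEquiv hAO').toRingEquiv]
    exact hdim𝔪
  -- clean LU at the refined centre
  obtain ⟨A', hA'O', hAA', hA'fg, hregA'O', c, hc, hloose⟩ :=
    hLU k K O' A hAO' hAfg hfrac hdimA hregO' hdimO' g₀ hg₀
  -- `Frac (A'_centre) = K`
  have hAS : A.toSubring ≤ locAtCentre A'.toSubring O' := fun x hx => le_locAtCentre A'.toSubring O' (hAA' hx)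
  have hfrac' : IsFractionRing (locAtCentre A'.toSubring O') K := by
    refine IsFractionRing.of_field (locAtCentre A'.toSubring O') K fun z => ?_
    obtain ⟨a, b, -, hab⟩ := IsFractionRing.div_surjective (A := A) z
    exact ⟨⟨a, hAS a.2⟩, ⟨b, hAS b.2⟩, hab.symm⟩
  -- generise to the centre of `O`
  obtain ⟨hregA'O, α, e, d, hα, he, hloose'⟩ :=
    looseClean_generises_of_le p hO'O A'.toSubring hA'O' hregA'O' hfrac' (∑ j : Fin p, c j ^ p * g₀ ^ (j : ℕ)) hloose
  -- re-normalise the representative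
  obtain ⟨c', hc', hsum⟩ := nonTrivRep_twist p g₀ (fun b => hg₀ b) c hc α hα e d he
  refine ⟨A', fun x hx => hO'O (hA'O' hx), hAA', hA'fg, hregA'O, c', hc', ?_⟩
  rw [hsum]
  exact hloose'

end Summit.ResolutionOfSingularities.ResolutionOfSingularities.Theorems.RadicialJung.CleanModels

end
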